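import Summits.MatrixMultiplication.OmegaCensus.Cyclo7Data

/-!
# ω-census, family (b3): conjecture C9 — `(ℤ[ζ₇]/p) ⋊ C₇`: exact-count CERTIFICATES, part 1 (primes `11 ≤ p ≤ 67`)

HONEST FRAMING (pub-omega census; verbatim): lottery ticket; floor = certified bounds/negative ranges.
Census BOOKKEEPING (conjecture C9 of the cell; pub-omega stpp-1 gen 22).  ONE datum for all primes: box `α = (1 + ζ)/2`,
`β = −ζ(1 + ζ)/2`, `t = 3` (`A = (1,1,0,0,0,0)`, `B = (0,−1,−1,0,0,0)` w.r.t. `1, ζ, …, ζ⁵`), a pattern of `144` of the `9·64`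
(column, phase-vector) half blocks and constant trims (total `258`, each coordinate `lo + hi ≤ 2`; exact errors `|E| ≤ 2`) — seat search
HOME/pub-omega-stpp-1-g22/code/inert7data.py, validated by literal `𝔽_p[X]/(Φ₇)` arithmetic (`0` conflicts among the `3 368 856` cells at
`p = 11`).  `zd7_ok`: the `p`-independent check (`decide`).  **`Z7Cyc.not_boxUseful_ge`**: every prime `p ≥ 139` (uniform count
`576 p⁶ ≤ 720 (p − 5)⁶`); **`zeta7_q`** for the 29 primes `11 ≤ q < 139` (exact count by `decide`); **`Z7Cyc.not_boxUseful`: for every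
prime `p ≥ 11`, `(ℤ[ζ₇]/p) ⋊ ℤ/7` (order `7p⁶`) is not box-useful** — box ratio `≥ 9/5`.  For `p ≡ 3, 5 (mod 7)` (`ord₇ p = 6`:
`p = 17, 19, 31, 47, 59, 61, …`) these are the Schmidt atoms `A(p,7) = 𝔽_{p⁶} ⋊ C₇`.  Left open here: `p = 3, 5` (`𝔽_{3⁶} ⋊ C₇`,
`𝔽_{5⁶} ⋊ C₇`: the `p = 5` count of this datum is `24177 < 28125`).  Nothing here is progress on `ω`.
-/

namespace Summit.MatrixMultiplication.OmegaCensus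

namespace Z7Cyc

open Cyclo7

/-- `1 < 11`. [folklore] -/
instance fact_one_lt_11 : Fact (1 < 11) := ⟨by norm_num⟩

/-- `(ℤ[ζ₇]/11) ⋊ C₇` (order `12400927`) is not box-useful (exact count `3368856 ≥ 3188810`). [folklore] -/
theorem zeta7_11 : ¬ BoxUseful (Z7Cyc 11) :=
  haveI : Fact (Nat.Prime 11) := ⟨by norm_num⟩
  not_boxUseful_of_count7 (by norm_num) zd7 zd7_ok (by norm_num) (by decide +kernel)

/-- `1 < 13`. [folklore] -/
instance fact_one_lt_13 : Fact (1 < 13) := ⟨by norm_num⟩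

/-- `(ℤ[ζ₇]/13) ⋊ C₇` (order `33787663`) is not box-useful (exact count `9421417 ≥ 8688257`). [folklore] -/
theorem zeta7_13 : ¬ BoxUseful (Z7Cyc 13) :=
  haveI : Fact (Nat.Prime 13) := ⟨by norm_num⟩
  not_boxUseful_of_count7 (by norm_num) zd7 zd7_ok (by norm_num) (by decide +kernel)

/-- `1 < 17`. [folklore] -/
instance fact_one_lt_17 : Fact (1 < 17) := ⟨by norm_num⟩

/-- `(ℤ[ζ₇]/17) ⋊ C₇` (order `168962983`) is not box-useful (exact count `48726129 ≥ 43447625`). [folklore] -/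
theorem zeta7_17 : ¬ BoxUseful (Z7Cyc 17) :=
  haveI : Fact (Nat.Prime 17) := ⟨by norm_num⟩
  not_boxUseful_of_count7 (by norm_num) zd7 zd7_ok (by norm_num) (by decide +kernel)

/-- `1 < 19`. [folklore] -/
instance fact_one_lt_19 : Fact (1 < 19) := ⟨by norm_num⟩

/-- `(ℤ[ζ₇]/19) ⋊ C₇` (order `329321167`) is not box-useful (exact count `96067432 ≥ 84682586`). [folklore] -/
theorem zeta7_19 : ¬ BoxUseful (Z7Cyc 19) :=
  haveI : Fact (Nat.Prime 19) := ⟨by norm_num⟩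
  not_boxUseful_of_count7 (by norm_num) zd7 zd7_ok (by norm_num) (by decide +kernel)

/-- `1 < 23`. [folklore] -/
instance fact_one_lt_23 : Fact (1 < 23) := ⟨by norm_num⟩

/-- `(ℤ[ζ₇]/23) ⋊ C₇` (order `1036251223`) is not box-useful (exact count `307454412 ≥ 266464601`). [folklore] -/
theorem zeta7_23 : ¬ BoxUseful (Z7Cyc 23) :=
  haveI : Fact (Nat.Prime 23) := ⟨by norm_num⟩
  not_boxUseful_of_count7 (by norm_num) zd7 zd7_ok (by norm_num) (by decide +kernel)

/-- `1 < 29`. [folklore] -/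
instance fact_one_lt_29 : Fact (1 < 29) := ⟨by norm_num⟩

/-- `(ℤ[ζ₇]/29) ⋊ C₇` (order `4163763247`) is not box-useful (exact count `1256089017 ≥ 1070681978`). [folklore] -/
theorem zeta7_29 : ¬ BoxUseful (Z7Cyc 29) :=
  haveI : Fact (Nat.Prime 29) := ⟨by norm_num⟩
  not_boxUseful_of_count7 (by norm_num) zd7 zd7_ok (by norm_num) (by decide +kernel)

/-- `1 < 31`. [folklore] -/
instance fact_one_lt_31 : Fact (1 < 31) := ⟨by norm_num⟩

/-- `(ℤ[ζ₇]/31) ⋊ C₇` (order `6212525767`) is not box-useful (exact count `1881853516 ≥ 1597506626`). [folklore] -/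
theorem zeta7_31 : ¬ BoxUseful (Z7Cyc 31) :=
  haveI : Fact (Nat.Prime 31) := ⟨by norm_num⟩
  not_boxUseful_of_count7 (by norm_num) zd7 zd7_ok (by norm_num) (by decide +kernel)

/-- `1 < 37`. [folklore] -/
instance fact_one_lt_37 : Fact (1 < 37) := ⟨by norm_num⟩

/-- `(ℤ[ζ₇]/37) ⋊ C₇` (order `17960084863`) is not box-useful (exact count `5493078289 ≥ 4618307537`). [folklore] -/
theorem zeta7_37 : ¬ BoxUseful (Z7Cyc 37) :=
  haveI : Fact (Nat.Prime 37) := ⟨by norm_num⟩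
  not_boxUseful_of_count7 (by norm_num) zd7 zd7_ok (by norm_num) (by decide +kernel)

/-- `1 < 41`. [folklore] -/
instance fact_one_lt_41 : Fact (1 < 41) := ⟨by norm_num⟩

/-- `(ℤ[ζ₇]/41) ⋊ C₇` (order `33250729687`) is not box-useful (exact count `10219245321 ≥ 8550187634`). [folklore] -/
theorem zeta7_41 : ¬ BoxUseful (Z7Cyc 41) :=
  haveI : Fact (Nat.Prime 41) := ⟨by norm_num⟩
  not_boxUseful_of_count7 (by norm_num) zd7 zd7_ok (by norm_num) (by decide +kernel)

/-- `1 < 43`. [folklore] -/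
instance fact_one_lt_43 : Fact (1 < 43) := ⟨by norm_num⟩

/-- `(ℤ[ζ₇]/43) ⋊ C₇` (order `44249541343`) is not box-useful (exact count `13628057752 ≥ 11378453489`). [folklore] -/
theorem zeta7_43 : ¬ BoxUseful (Z7Cyc 43) :=
  haveI : Fact (Nat.Prime 43) := ⟨by norm_num⟩
  not_boxUseful_of_count7 (by norm_num) zd7 zd7_ok (by norm_num) (by decide +kernel)

/-- `1 < 47`. [folklore] -/
instance fact_one_lt_47 : Fact (1 < 47) := ⟨by norm_num⟩

/-- `(ℤ[ζ₇]/47) ⋊ C₇` (order `75454507303`) is not box-useful (exact count `23323475244 ≥ 19402587593`). [folklore] -/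
theorem zeta7_47 : ¬ BoxUseful (Z7Cyc 47) :=
  haveI : Fact (Nat.Prime 47) := ⟨by norm_num⟩
  not_boxUseful_of_count7 (by norm_num) zd7 zd7_ok (by norm_num) (by decide +kernel)

/-- `1 < 53`. [folklore] -/
instance fact_one_lt_53 : Fact (1 < 53) := ⟨by norm_num⟩

/-- `(ℤ[ζ₇]/53) ⋊ C₇` (order `155150527903`) is not box-useful (exact count `48171128097 ≥ 39895850033`). [folklore] -/
theorem zeta7_53 : ¬ BoxUseful (Z7Cyc 53) :=
  haveI : Fact (Nat.Prime 53) := ⟨by norm_num⟩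
  not_boxUseful_of_count7 (by norm_num) zd7 zd7_ok (by norm_num) (by decide +kernel)

/-- `1 < 59`. [folklore] -/
instance fact_one_lt_59 : Fact (1 < 59) := ⟨by norm_num⟩

/-- `(ℤ[ζ₇]/59) ⋊ C₇` (order `295263735487`) is not box-useful (exact count `91997677272 ≥ 75924960554`). [folklore] -/
theorem zeta7_59 : ¬ BoxUseful (Z7Cyc 59) :=
  haveI : Fact (Nat.Prime 59) := ⟨by norm_num⟩
  not_boxUseful_of_count7 (by norm_num) zd7 zd7_ok (by norm_num) (by decide +kernel)

/-- `1 < 61`. [folklore] -/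
instance fact_one_lt_61 : Fact (1 < 61) := ⟨by norm_num⟩

/-- `(ℤ[ζ₇]/61) ⋊ C₇` (order `360642620527`) is not box-useful (exact count `112483217881 ≥ 92736673850`). [folklore] -/
theorem zeta7_61 : ¬ BoxUseful (Z7Cyc 61) :=
  haveI : Fact (Nat.Prime 61) := ⟨by norm_num⟩
  not_boxUseful_of_count7 (by norm_num) zd7 zd7_ok (by norm_num) (by decide +kernel)

/-- `1 < 67`. [folklore] -/
instance fact_one_lt_67 : Fact (1 < 67) := ⟨by norm_num⟩

/-- `(ℤ[ζ₇]/67) ⋊ C₇` (order `633208675183`) is not box-useful (exact count `198029580904 ≥ 162825087905`). [folklore] -/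
theorem zeta7_67 : ¬ BoxUseful (Z7Cyc 67) :=
  haveI : Fact (Nat.Prime 67) := ⟨by norm_num⟩
  not_boxUseful_of_count7 (by norm_num) zd7 zd7_ok (by norm_num) (by decide +kernel)

end Z7Cyc

end Summit.MatrixMultiplication.OmegaCensus
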